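import Summits.BirchSwinnertonDyer.BirchSwinnertonDyer.Theorems.SignedLowerHalvesSmallImageLowerHalfBothSignsRttD2SeqSemilocLevelOps
import Literature.NumberTheory.GaloisRepresentations.CorestrictionAlongHom
import Literature.NumberTheory.ComplexMultiplication.EllipticUnits.ImaginaryQuadraticMainConjectureCarriersOCoresTransitive
import HarnessLib

/-!
# Route `SignedLowerHalves`, crux L `SmallImageLowerHalfBothSigns` (stmt-BirchSwinnertonDyer-23599), line `rtt_w3` v29 — stub S3α (`stub_junctionSha_ns`, row J4),
# brick ρ₂ (part 1): THE SEMILOCALISATION OF honda's LAYER CLASSES IN EVERY DEGREE `q`, `sloc^q_{w,n,k} = res_w ∘ sh_{U_n}⁻¹ ∘ infl_n : H^q(G_P(K_n), X_k) → H^q(Γ_{K_w}, Maps(Γ_K ⧸ U_n, X_k))`,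
# and its four laws (corestriction ↦ fibre sum, reduction, `𝒪`-scalars, and — in degree `2` — conjugation ↦ right translation) + the degree-`2` semilocal vanishing criterion

INPUTS hand `bsd-inputs-honda-p1` g28 under LEAD `cruxlead-stmt-BirchSwinnertonDyer-23599` g14 (cell `bsd-ssimc`; TAKE-GRANT 2026-08-31T06:30Z «ρ₂ = the degree-2 semilocal map»);
helper `--supports stmt-BirchSwinnertonDyer-23599`. DEFINITIONS WITH BODIES + THEOREMS; no named fact, no instance, no `sorry`.
WHY. Row S3α bounds `λ(𝐇²_{Iw,P}(K_∞,T*)₂ ⧸ T₁)` through the Ш²-sequence socket `lambdaInvariant_le_of_sha_range` (LEAD g14, p812938): `e = sp²` (α1, landed p812941/p813152),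
`ρ = ρ₂ : I₂.H → Π_{w∈P} (L₂ w).H` the DEGREE-2 semilocalisation, `π` the tower Poitou–Tate map (α5′). The degree-1 semilocalisation is -w3's T1-a/T2
(`SmallImageRttD2Seq.semilocNK`, `semilocMap`); this file is its degree-general twin at the level of the layers. The one new ingredient is ★ `inflNKq_cycLayerCoresO`: the inflation
`H^q(G_P(K_n), X_k) → H^q(U_n, X_k)` commutes with the corestrictions of the tower IN EVERY DEGREE — honda g27's `map_relCor_eq_relCor_map_of_bijective` (p813457) for the pair
`(Γ_K ↠ G_P, id)`, bijective on `U_n ⧸ U_{n+1} → (U_n)_P ⧸ (U_{n+1})_P` because `N_P ≤ U_{n+1}` (the degree-1 proof went through cocycles, `Kato2004.map_coresLe_eq_coresLe_map`).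
HONEST FRAMING: bookkeeping in continuous cohomology; nothing about S3α, E2, crux L or BSD is proved; all remain OPEN and are proved for NO curve.

* §1 `inflNKq q n k` (= R4's `inflNK` for `q = 1`, `inflNKq_one`), `conjMap_inflNKq`, `cohomologyMap_coeffHomK_inflNKq`, ★ `inflNKq_cycLayerCoresO` (needs `N_P ≤ U_{n+1}`).
* §2 `semilocNKq q n k := res_w ∘ sh⁻¹ ∘ inflNKq` (= T1-a's `semilocNK` for `q = 1`, `semilocNKq_one`), laws `semilocNKq_levelMapHomO` (⇒ `semilocNKq_red`, `semilocNKq_scalar`), ★ `semilocNKq_cores`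
  (every degree), `semilocNK₂_conj` (degree `2`: the tree's Shapiro/conjugation dictionary `shapiroCoindFinAddEquiv_rTransHom_two`), ★★ `semilocNK₂_eq_zero_iff` (degree `2`:
  `sloc²_{w,n,k} y = 0 ↔ ∀ δ, loc²_{n,w}(conj_δ y) = 0`, the tree's `map_restrict_eq_zero_iff_forall_conjMap_two`).
References: [NeukirchSchmidtWingberg2008] I §5 Prop. 1.5.4, (1.5.6)–(1.5.7), I §6 (1.6.4)–(1.6.5), (8.6.2); [SerreGaloisCohomology1997] I §2.4–§2.5; [SerreLocalFields1979] VII §5–§6;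
[Rubin2000] App. B.3; [Kato2004Asterisque] §8.2, §17.13.
-/

set_option autoImplicit false
set_option linter.dupNamespace false -- D-0017: single-problem summit, the namespace repeats the problem name by design
noncomputable section

open scoped Classical
open NumberField IsDedekindDomain Field CategoryTheory Function

namespace Summit.BirchSwinnertonDyer.BirchSwinnertonDyer.Theorems.SmallImageRttJunctionSha

open Literature.NumberTheory.EllipticCurves Literature.NumberTheory.GaloisRepresentations
  Literature.NumberTheory.ComplexMultiplication.EllipticUnits.JohnsonLeungKings2011
  Summit.BirchSwinnertonDyer.BirchSwinnertonDyer.Theorems.SmallImageRttD2J1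
  Summit.BirchSwinnertonDyer.BirchSwinnertonDyer.Theorems.SmallImageRttD2Seq

section Infl

variable {K : Type} [Field K] [NumberField K] {p : ℕ} [Fact p.Prime] (S : Set (PadicAlgCl p)) (κ : ZpExtension K p)
  (θ' : absoluteGaloisGroup K →ₜ* (padicCoeffIntegers S)ˣ) (P : Set (HeightOneSpectrum (𝓞 K)))

/-! ## §1. The inflation in degree `q` -/

/-- ★ **The inflation `infl^q_n : H^q(G_P(K_n), X_k) → H^q(U_n, X_k)`** in every degree `q` (pull-back along `U_n → (U_n)_P`, identity on coefficients; R4's `inflNK` is `q = 1`).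
[cite: NeukirchSchmidtWingberg2008, I §5] [cite: SerreGaloisCohomology1997, I §2.4] -/
def inflNKq (q n k : ℕ) :
    cycLayerCohO S κ θ' P n k q →+ (continuousCohomology q (subgroupRep (coeffRepK S θ' P k).toTopRep (κ.layerSubgroup n)) : Type) :=
  (ContinuousCohomology.map (layerQuotHom κ P n) (inflMod S κ θ' P n k) q).hom.toLinearMap.toAddMonoidHom

omit [NumberField K] in
/-- Unfolding `inflNKq`. [folklore] -/
theorem inflNKq_apply (q n k : ℕ) (y : cycLayerCohO S κ θ' P n k q) :
    inflNKq S κ θ' P q n k y = ContinuousCohomology.map (layerQuotHom κ P n) (inflMod S κ θ' P n k) q y :=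
  rfl

omit [NumberField K] in
/-- `inflNKq 1 = inflNK` (R4). [folklore] -/
theorem inflNKq_one (n k : ℕ) : inflNKq S κ θ' P 1 n k = inflNK S κ θ' P n k := rfl

omit [NumberField K] in
/-- ★ **`g · infl^q_n y = infl^q_n (conj_g y)`** in every degree (R4's `conjMap_inflNK` is `q = 1`; same pair of compatible maps). [cite: NeukirchSchmidtWingberg2008, I §5 Prop. 1.5.3 (iii)]
[cite: SerreLocalFields1979, VII §5] -/
theorem conjMap_inflNKq (q n k : ℕ) (g : absoluteGaloisGroup K) (y : cycLayerCohO S κ θ' P n k q) :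
    conjMap (coeffRepK S θ' P k).toTopRep (κ.layerSubgroup n) g q (inflNKq S κ θ' P q n k y) = inflNKq S κ θ' P q n k (cycLayerConjO S κ θ' P n k q g y) := by
  haveI : (imGS P (κ.layerSubgroup n)).Normal := Subgroup.Normal.map inferInstance _ (toUnramifiedQuot_surjective K P)
  rw [inflNKq_apply, inflNKq_apply, cycLayerConjO, levelConjO_apply]
  unfold conjMap
  have e1 := map_comp_apply_of (layerQuotHom κ P n) (Literature.NumberTheory.EllipticCurves.subgroupConj _ g)
      ((layerQuotHom κ P n).comp (Literature.NumberTheory.EllipticCurves.subgroupConj _ g)) (fun _ ↦ rfl)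
      (inflMod S κ θ' P n k) (conjRepHom (coeffRepK S θ' P k).toTopRep _ g)
      (TopRep.ofHom ⟨((coeffGSO S P θ' k).toTopRep.ρ (toUnramifiedQuot K P g) : _ →L[ℤ] _), fun u ↦ ContinuousLinearMap.ext fun x ↦ by
        change (coeffGSO S P θ' k) (toUnramifiedQuot K P g) ((coeffGSO S P θ' k) (toUnramifiedQuot K P ((g⁻¹ * u * g : absoluteGaloisGroup K))) x) =
          (coeffGSO S P θ' k) (toUnramifiedQuot K P (u : absoluteGaloisGroup K)) ((coeffGSO S P θ' k) (toUnramifiedQuot K P g) x)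
        rw [← Module.End.mul_apply, ← map_mul, ← Module.End.mul_apply, ← map_mul, ← map_mul, ← map_mul, ← mul_assoc, ← mul_assoc, mul_inv_cancel,
          one_mul]⟩) (fun _ ↦ rfl) q y
  have e2 := map_comp_apply_of (Literature.NumberTheory.EllipticCurves.subgroupConj _ (toUnramifiedQuot K P g)) (layerQuotHom κ P n)
      ((layerQuotHom κ P n).comp (Literature.NumberTheory.EllipticCurves.subgroupConj _ g))
      (fun u ↦ Subtype.ext (by simp [layerQuotHom_apply_coe, Literature.NumberTheory.EllipticCurves.subgroupConj_apply_coe, map_mul, map_inv]))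
      (conjRepHom (coeffGSO S P θ' k).toTopRep _ (toUnramifiedQuot K P g)) (inflMod S κ θ' P n k)
      (TopRep.ofHom ⟨((coeffGSO S P θ' k).toTopRep.ρ (toUnramifiedQuot K P g) : _ →L[ℤ] _), fun u ↦ ContinuousLinearMap.ext fun x ↦ by
        change (coeffGSO S P θ' k) (toUnramifiedQuot K P g) ((coeffGSO S P θ' k) (toUnramifiedQuot K P ((g⁻¹ * u * g : absoluteGaloisGroup K))) x) =
          (coeffGSO S P θ' k) (toUnramifiedQuot K P (u : absoluteGaloisGroup K)) ((coeffGSO S P θ' k) (toUnramifiedQuot K P g) x)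
        rw [← Module.End.mul_apply, ← map_mul, ← Module.End.mul_apply, ← map_mul, ← map_mul, ← map_mul, ← mul_assoc, ← mul_assoc, mul_inv_cancel,
          one_mul]⟩) (fun _ ↦ rfl) q y
  exact e1.symm.trans e2

omit [NumberField K] in
/-- ★ **The inflation commutes with every change of coefficients, every degree**: `H^q(f|_{U_n}) (infl^q_n y) = infl^q_n (H^q(f) y)`.
[cite: NeukirchSchmidtWingberg2008, I §5] [cite: Kato2004Asterisque, §8.2 (p. 180)] -/
theorem cohomologyMap_coeffHomK_inflNKq {k k' : ℕ} (f : OMuCarrier K S (p ^ k) →+ OMuCarrier K S (p ^ k'))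
    (hf : ∀ (σ : absoluteGaloisGroup K) (x : OMuCarrier K S (p ^ k)), f (muTwistO S θ' k σ x) = muTwistO S θ' k' σ (f x)) (q n : ℕ)
    (y : cycLayerCohO S κ θ' P n k q) :
    cohomologyMap (subgroupRepMap (coeffHomK S θ' P f hf) (κ.layerSubgroup n)) q (inflNKq S κ θ' P q n k y) =
      inflNKq S κ θ' P q n k' ((ContinuousCohomology.map (ContinuousMonoidHom.id _) (levelMapHomO S P θ' (κ.layerSubgroup n) f hf) q).hom y) := by
  rw [inflNKq_apply, inflNKq_apply]
  have e1 := map_comp_apply_of (layerQuotHom κ P n) (ContinuousMonoidHom.id _) (layerQuotHom κ P n) (fun _ ↦ rfl)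
      (inflMod S κ θ' P n k) (resIdHom (subgroupRepMap (coeffHomK S θ' P f hf) (κ.layerSubgroup n)))
      (TopRep.ofHom ⟨⟨coeffMapO S P θ' f hf, continuous_of_discreteTopology⟩, fun u ↦ by
        ext x
        exact congrArg Subtype.val (Subtype.ext (hf _ (x : OMuCarrier K S (p ^ k))) :
          coeffMapO S P θ' f hf ((coeffRepK S θ' P k) (u : absoluteGaloisGroup K) x) =
            (coeffRepK S θ' P k') (u : absoluteGaloisGroup K) (coeffMapO S P θ' f hf x))⟩) (fun _ ↦ rfl) q y
  have e2 := map_comp_apply_of (ContinuousMonoidHom.id _) (layerQuotHom κ P n) (layerQuotHom κ P n) (fun _ ↦ rfl)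
      (levelMapHomO S P θ' (κ.layerSubgroup n) f hf) (inflMod S κ θ' P n k')
      (TopRep.ofHom ⟨⟨coeffMapO S P θ' f hf, continuous_of_discreteTopology⟩, fun u ↦ by
        ext x
        exact congrArg Subtype.val (Subtype.ext (hf _ (x : OMuCarrier K S (p ^ k))) :
          coeffMapO S P θ' f hf ((coeffRepK S θ' P k) (u : absoluteGaloisGroup K) x) =
            (coeffRepK S θ' P k') (u : absoluteGaloisGroup K) (coeffMapO S P θ' f hf x))⟩) (fun _ ↦ rfl) q y
  exact e1.symm.trans e2

/-- ★★ **`infl^q_n ∘ cor_{K_{n+1}/K_n} = relCor_{U_{n+1} → U_n} ∘ infl^q_{n+1}` IN EVERY DEGREE** on honda's layer classes: honda's `cycLayerCoresO` is the relative corestriction of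
`(U_{n+1})_P ≤ (U_n)_P` (`relCoresO_eq_relCor`), carried along the inflation pair `(Γ_K ↠ G_P, id)` to the relative corestriction of `U_{n+1} ≤ U_n` by the naturality of `relCor`
in compatible pairs (`map_relCor_eq_relCor_map_of_bijective`), the induced map `U_n ⧸ U_{n+1} → (U_n)_P ⧸ (U_{n+1})_P` being a bijection as `N_P ≤ U_{n+1}`. The `Fintype` instance is
arbitrary. [cite: NeukirchSchmidtWingberg2008, I §5 Prop. 1.5.4 and (1.5.6)] [cite: SerreGaloisCohomology1997, I §2.4–§2.5] -/
theorem inflNKq_cycLayerCoresO (hNP : ∀ n, ramificationSubgroup K P ≤ κ.layerSubgroup n) (q n k : ℕ)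
    [Fintype (↥(κ.layerSubgroup n) ⧸ (κ.layerSubgroup (n + 1)).subgroupOf (κ.layerSubgroup n))] (y : cycLayerCohO S κ θ' P (n + 1) k q) :
    haveI : IsClosed ((κ.layerSubgroup n : Subgroup (absoluteGaloisGroup K)) : Set (absoluteGaloisGroup K)) := Subgroup.isClosed_of_isOpen _ (κ.isOpen_layerSubgroup n)
    haveI : IsClosed ((κ.layerSubgroup (n + 1) : Subgroup (absoluteGaloisGroup K)) : Set (absoluteGaloisGroup K)) :=
      Subgroup.isClosed_of_isOpen _ (κ.isOpen_layerSubgroup (n + 1))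
    inflNKq S κ θ' P q n k (cycLayerCoresO S κ θ' P n k q y) =
      relCor (κ.layerSubgroup n) (κ.layerSubgroup (n + 1)) (coeffRepK S θ' P k) (κ.layerSubgroup_antitone (Nat.le_succ n)) q (inflNKq S κ θ' P q (n + 1) k y) := by
  haveI : TotallyDisconnectedSpace (GaloisGroupUnramifiedOutside K P) :=
    Literature.GroupTheory.ProfiniteSubquotients.totallyDisconnectedSpace_quotient (ramificationSubgroup K P) (ramificationSubgroup_isClosed K P)
  haveI hc1 : IsClosed ((imGS P (κ.layerSubgroup n) : Subgroup (GaloisGroupUnramifiedOutside K P)) : Set (GaloisGroupUnramifiedOutside K P)) :=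
    isClosed_imGS' P (κ.isOpen_layerSubgroup n)
  haveI hc2 : IsClosed ((imGS P (κ.layerSubgroup (n + 1)) : Subgroup (GaloisGroupUnramifiedOutside K P)) : Set (GaloisGroupUnramifiedOutside K P)) :=
    isClosed_imGS' P (κ.isOpen_layerSubgroup (n + 1))
  haveI : ((imGS P (κ.layerSubgroup (n + 1))).subgroupOf (imGS P (κ.layerSubgroup n))).FiniteIndex := by
    haveI := finiteIndex_imGS' P (κ.isOpen_layerSubgroup (n + 1)); infer_instance
  letI : Fintype (↥(imGS P (κ.layerSubgroup n)) ⧸ (imGS P (κ.layerSubgroup (n + 1))).subgroupOf (imGS P (κ.layerSubgroup n))) := Fintype.ofFinite _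
  haveI : IsClosed ((κ.layerSubgroup n : Subgroup (absoluteGaloisGroup K)) : Set (absoluteGaloisGroup K)) := Subgroup.isClosed_of_isOpen _ (κ.isOpen_layerSubgroup n)
  haveI : IsClosed ((κ.layerSubgroup (n + 1) : Subgroup (absoluteGaloisGroup K)) : Set (absoluteGaloisGroup K)) :=
    Subgroup.isClosed_of_isOpen _ (κ.isOpen_layerSubgroup (n + 1))
  -- the hypotheses of `map_relCor_eq_relCor_map_of_bijective` for the pair `(Γ_K ↠ G_P, id)`
  have hV : ∀ v : ↥(κ.layerSubgroup n), toUnramifiedQuotCont K P (v : absoluteGaloisGroup K) ∈ imGS P (κ.layerSubgroup n) :=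
    fun v ↦ Subgroup.mem_map_of_mem _ v.2
  have hV' : ∀ v : ↥(κ.layerSubgroup (n + 1)), toUnramifiedQuotCont K P (v : absoluteGaloisGroup K) ∈ imGS P (κ.layerSubgroup (n + 1)) :=
    fun v ↦ Subgroup.mem_map_of_mem _ v.2
  have hbij : Function.Bijective (quotAlong ((κ.layerSubgroup (n + 1)).subgroupOf (κ.layerSubgroup n))
      ((imGS P (κ.layerSubgroup (n + 1))).subgroupOf (imGS P (κ.layerSubgroup n)))
      (subAlong (κ.layerSubgroup n) (imGS P (κ.layerSubgroup n)) (toUnramifiedQuotCont K P) hV)) := by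
    refine bijective_quotAlong_of_surjective _ _ _
      (subAlong_mem_subgroupOf (κ.layerSubgroup n) (κ.layerSubgroup (n + 1)) (imGS P (κ.layerSubgroup n)) (imGS P (κ.layerSubgroup (n + 1)))
        (toUnramifiedQuotCont K P) hV hV') (fun g ↦ ?_) (fun u hu ↦ ?_)
    · -- `U_n → (U_n)_P` is onto
      obtain ⟨u, hu, hug⟩ := Subgroup.mem_map.mp g.2
      exact ⟨⟨u, hu⟩, Subtype.ext hug⟩
    · -- `ē(u) ∈ (U_{n+1})_P ⇒ u ∈ U_{n+1}` (`N_P ≤ U_{n+1}`)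
      rw [Subgroup.mem_subgroupOf] at hu ⊢
      obtain ⟨u', hu', he⟩ := Subgroup.mem_map.mp hu
      have h1 : u'⁻¹ * ((u : ↥(κ.layerSubgroup n)) : absoluteGaloisGroup K) ∈ ramificationSubgroup K P := by
        rw [← QuotientGroup.eq]; exact he
      have h2 := mul_mem hu' (hNP (n + 1) h1)
      rwa [mul_inv_cancel_left] at h2
  rw [inflNKq_apply, inflNKq_apply, cycLayerCoresO, relCoresO_eq_relCor]
  have key := map_relCor_eq_relCor_map_of_bijective (κ.layerSubgroup n) (κ.layerSubgroup (n + 1)) (imGS P (κ.layerSubgroup n)) (imGS P (κ.layerSubgroup (n + 1)))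
    (coeffGSO S P θ' k) (coeffRepK S θ' P k) (toUnramifiedQuotCont K P) (idAlong (coeffGSO S P θ' k) (toUnramifiedQuotCont K P))
    (κ.layerSubgroup_antitone (Nat.le_succ n)) (imGS_le_of_le P (κ.layerSubgroup_antitone (Nat.le_succ n))) hV hV' hbij q y
  -- both inflation maps of `key` ARE `infl^q` (same pairs)
  have eL : ContinuousCohomology.map (subAlong (κ.layerSubgroup n) (imGS P (κ.layerSubgroup n)) (toUnramifiedQuotCont K P) hV)
      (subAlongMod (κ.layerSubgroup n) (imGS P (κ.layerSubgroup n)) (coeffGSO S P θ' k) (toUnramifiedQuotCont K P) hV (coeffRepK S θ' P k)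
        (idAlong (coeffGSO S P θ' k) (toUnramifiedQuotCont K P))) q =
      ContinuousCohomology.map (layerQuotHom κ P n) (inflMod S κ θ' P n k) q :=
    continuousCohomology_map_congr (ContinuousMonoidHom.ext fun _ ↦ rfl) _ _ (fun _ ↦ rfl) q
  have eR : ContinuousCohomology.map (subAlong (κ.layerSubgroup (n + 1)) (imGS P (κ.layerSubgroup (n + 1))) (toUnramifiedQuotCont K P) hV')
      (subAlongMod (κ.layerSubgroup (n + 1)) (imGS P (κ.layerSubgroup (n + 1))) (coeffGSO S P θ' k) (toUnramifiedQuotCont K P) hV' (coeffRepK S θ' P k)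
        (idAlong (coeffGSO S P θ' k) (toUnramifiedQuotCont K P))) q =
      ContinuousCohomology.map (layerQuotHom κ P (n + 1)) (inflMod S κ θ' P (n + 1) k) q :=
    continuousCohomology_map_congr (ContinuousMonoidHom.ext fun _ ↦ rfl) _ _ (fun _ ↦ rfl) q
  rw [eL, eR] at key
  exact key

end Infl

section Semiloc

variable {K : Type} [Field K] [NumberField K] {p : ℕ} [Fact p.Prime] (S : Set (PadicAlgCl p)) (κ : ZpExtension K p)
  (θ' : absoluteGaloisGroup K →ₜ* (padicCoeffIntegers S)ˣ) (P : Set (HeightOneSpectrum (𝓞 K))) (w : HeightOneSpectrum (𝓞 K))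

/-! ## §2. The semilocalisation in degree `q` and its laws -/

/-- ★ **The semilocalisation `sloc^q_{w,n,k} = res_w ∘ sh_{U_n}⁻¹ ∘ infl^q_n : H^q(G_P(K_n), X_k) →+ Lloc_w(n,k)^q = H^q(Γ_{K_w}, Maps(Γ_K ⧸ U_n, X_k))`** in every degree `q`
(T1-a's `semilocNK` is `q = 1`): under Mackey–Shapiro the vector of ALL localisations of the class at the places of `K_n` above `w`.
[cite: NeukirchSchmidtWingberg2008, I §6 (1.6.4)–(1.6.5), (8.6.2)] [cite: Rubin2000, App. B.3] -/
def semilocNKq (q n k : ℕ) : cycLayerCohO S κ θ' P n k q →+ semilocCoh S κ θ' P w n k q :=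
  (semilocRes S κ θ' P w n k q).comp
    ((((coeffRepK S θ' P k).shapiroCoindFinAddEquiv (κ.layerSubgroup n) (κ.isOpen_layerSubgroup n) q).symm.toAddMonoidHom).comp
      (inflNKq S κ θ' P q n k))

/-- Unfolding `semilocNKq`. [folklore] -/
theorem semilocNKq_apply (q n k : ℕ) (y : cycLayerCohO S κ θ' P n k q) :
    semilocNKq S κ θ' P w q n k y =
      semilocRes S κ θ' P w n k q (((coeffRepK S θ' P k).shapiroCoindFinAddEquiv (κ.layerSubgroup n) (κ.isOpen_layerSubgroup n) q).symm (inflNKq S κ θ' P q n k y)) :=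
  rfl

/-- `semilocNKq 1 = semilocNK` (T1-a). [folklore] -/
theorem semilocNKq_one (n k : ℕ) : semilocNKq S κ θ' P w 1 n k = semilocNK S κ θ' P w n k := rfl

/-- ★ **`sloc^q ∘ H^q(f) = H^q(Maps(f)|_{res_w}) ∘ sloc^q`** for every equivariant change of coefficients `f : X_k → X_{k′}`, every degree (Shapiro is natural in the coefficients,
`shapiroCoindFinAddEquiv_cohomologyMap_coindFinMap`; §1). In T1-b's currency: `sloc^q (H^q(f) y) = semilocCoeff f (sloc^q y)`. [cite: NeukirchSchmidtWingberg2008, I §6 Prop. (1.6.4)] [cite: Kato2004Asterisque, §8.2 (p. 180)] -/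
theorem semilocNKq_levelMapHomO {k k' : ℕ} (f : OMuCarrier K S (p ^ k) →+ OMuCarrier K S (p ^ k'))
    (hf : ∀ (σ : absoluteGaloisGroup K) (x : OMuCarrier K S (p ^ k)), f (muTwistO S θ' k σ x) = muTwistO S θ' k' σ (f x)) (q n : ℕ)
    (y : cycLayerCohO S κ θ' P n k q) :
    semilocNKq S κ θ' P w q n k' ((ContinuousCohomology.map (ContinuousMonoidHom.id _) (levelMapHomO S P θ' (κ.layerSubgroup n) f hf) q).hom y) =
      semilocCoeff S κ θ' P w n f hf q (semilocNKq S κ θ' P w q n k y) := by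
  rw [semilocNKq_apply, semilocNKq_apply, semilocCoeff, semilocH_apply, ← semilocRes_cohomologyMap]
  congr 1
  rw [AddEquiv.symm_apply_eq, ContinuousRep.shapiroCoindFinAddEquiv_cohomologyMap_coindFinMap, AddEquiv.apply_symm_apply,
    cohomologyMap_coeffHomK_inflNKq]

/-- `sloc^q (red y) = semilocRed (sloc^q y)`. [cite: Kato2004Asterisque, §8.2 (p. 180)] -/
theorem semilocNKq_red (q n k : ℕ) (y : cycLayerCohO S κ θ' P n (k + 1) q) :
    semilocNKq S κ θ' P w q n k (cycLayerRedO S κ θ' P n k q y) = semilocRed S κ θ' P w n k q (semilocNKq S κ θ' P w q n (k + 1) y) :=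
  semilocNKq_levelMapHomO S κ θ' P w (oMuRed S k) (oMuRed_muTwistO S θ' k) q n y

/-- `sloc^q (c • y) = semilocScalar c (sloc^q y)`. [cite: JohnsonLeungKings2011, §4.1 Def. 4.1] -/
theorem semilocNKq_scalar (q n k : ℕ) (c : padicCoeffIntegers S) (y : cycLayerCohO S κ θ' P n k q) :
    semilocNKq S κ θ' P w q n k (cycLayerScalarO S κ θ' P n k q c y) = semilocScalar S κ θ' P w n k q c (semilocNKq S κ θ' P w q n k y) :=
  semilocNKq_levelMapHomO S κ θ' P w (oMuScalar S (p ^ k) c) (oMuScalar_muTwistO S θ' k c) q n y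

/-- ★★ **`sloc^q ∘ cor_{K_{n+1}/K_n} = semilocCores ∘ sloc^q` IN EVERY DEGREE** (needs `N_P ≤ U_m` for all `m`): §1 `inflNKq_cycLayerCoresO` (inflation ∘ cor = relCor ∘ inflation) and the
tree's all-degree Shapiro law `shapiroCoindFinAddEquiv_cohomologyMap_coindFinSum` (under Shapiro the relative corestriction is the FIBRE SUM of the coinduced coefficients; `Fintype`
instances arbitrary). [cite: NeukirchSchmidtWingberg2008, I §5 Prop. (1.5.3)–(1.5.4), (1.5.6)–(1.5.7), I §6 Prop. (1.6.4)] [cite: Rubin2000, App. B.3] -/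
theorem semilocNKq_cores (hNP : ∀ n, ramificationSubgroup K P ≤ κ.layerSubgroup n) (q n k : ℕ) (y : cycLayerCohO S κ θ' P (n + 1) k q) :
    semilocNKq S κ θ' P w q n k (cycLayerCoresO S κ θ' P n k q y) = semilocCores S κ θ' P w n k q (semilocNKq S κ θ' P w q (n + 1) k y) := by
  letI := layerQuotFintype κ n
  letI := layerQuotFintype κ (n + 1)
  haveI : (κ.layerSubgroup (n + 1)).FiniteIndex := ⟨by rw [κ.index_layerSubgroup (n + 1)]; exact pow_ne_zero _ (Fact.out : p.Prime).ne_zero⟩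
  letI : Fintype (↥(κ.layerSubgroup n) ⧸ (κ.layerSubgroup (n + 1)).subgroupOf (κ.layerSubgroup n)) := Fintype.ofFinite _
  haveI : IsClosed ((κ.layerSubgroup n : Subgroup (absoluteGaloisGroup K)) : Set (absoluteGaloisGroup K)) := Subgroup.isClosed_of_isOpen _ (κ.isOpen_layerSubgroup n)
  haveI : IsClosed ((κ.layerSubgroup (n + 1) : Subgroup (absoluteGaloisGroup K)) : Set (absoluteGaloisGroup K)) :=
    Subgroup.isClosed_of_isOpen _ (κ.isOpen_layerSubgroup (n + 1))
  rw [semilocNKq_apply, semilocNKq_apply, semilocCores, semilocH_apply, ← semilocRes_cohomologyMap]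
  congr 1
  rw [AddEquiv.symm_apply_eq, ContinuousRep.shapiroCoindFinAddEquiv_cohomologyMap_coindFinSum (coeffRepK S θ' P k) (κ.layerSubgroup_antitone (Nat.le_succ n))
      (κ.isOpen_layerSubgroup n) (κ.isOpen_layerSubgroup (n + 1)), AddEquiv.apply_symm_apply, inflNKq_cycLayerCoresO S κ θ' P hNP q n k y]

/-- ★ **`sloc² ∘ conj_γ = semilocConj γ ∘ sloc²`** (degree `2`): the conjugation action of `γ ∈ Γ_K` on honda's layer classes becomes the RIGHT TRANSLATION by `γ U_n` on the coinduced
coefficients (the tree's Shapiro/conjugation dictionary in degree `2`, `shapiroCoindFinAddEquiv_rTransHom_two`, and §1 `conjMap_inflNKq`). This is how `T = γ − 1` acts on `Lloc_w(n,k)²`.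
[cite: SerreLocalFields1979, VII §5] [cite: NeukirchSchmidtWingberg2008, I §6 Prop. (1.6.5)] -/
theorem semilocNK₂_conj (n k : ℕ) (γ : absoluteGaloisGroup K) (y : cycLayerCohO S κ θ' P n k 2) :
    semilocNKq S κ θ' P w 2 n k (cycLayerConjO S κ θ' P n k 2 γ y) = semilocConj S κ θ' P w n k 2 γ (semilocNKq S κ θ' P w 2 n k y) := by
  rw [semilocNKq_apply, semilocNKq_apply, semilocConj, semilocH_apply, ← semilocRes_cohomologyMap]
  congr 1
  rw [AddEquiv.symm_apply_eq, ContinuousRep.shapiroCoindFinAddEquiv_rTransHom_two, AddEquiv.apply_symm_apply, conjMap_inflNKq]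

/-- ★ **`θ_{U_n,w}^* ∘ infl^q_n = loc^q_{n,w}`** at every finite place `w`, every degree: restricting the inflated class along `U_{n,w} = res_w⁻¹ U_n → U_n` IS the pull-back along
`U_{n,w} → (U_n)_P` with the identity on vectors (g22's localisation; `locNK` in degree `1`, `map_comapSubtypeHom_inflNK`). [cite: NeukirchSchmidtWingberg2008, I §5 (1.5.6)] -/
theorem map_comapSubtypeHom_inflNKq (q n k : ℕ) (y : cycLayerCohO S κ θ' P n k q) :
    ContinuousCohomology.map (comapSubtypeHom (κ.layerSubgroup n) (resGalOfEmb (closureEmb (K := K) (w.adicCompletion K))))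
        (comapCoeffHom (coeffRepK S θ' P k).toTopRep (κ.layerSubgroup n) (resGalOfEmb (closureEmb (K := K) (w.adicCompletion K)))) q
        (inflNKq S κ θ' P q n k y) =
      ContinuousCohomology.map (locLayerHom κ P w n) (locLayerMod S κ θ' P w n k) q y := by
  rw [inflNKq_apply]
  exact (map_comp_apply_of (layerQuotHom κ P n) (comapSubtypeHom (κ.layerSubgroup n) (resGalOfEmb (closureEmb (K := K) (w.adicCompletion K))))
    (locLayerHom κ P w n) (fun _ ↦ rfl) (inflMod S κ θ' P n k)
    (comapCoeffHom (coeffRepK S θ' P k).toTopRep (κ.layerSubgroup n) (resGalOfEmb (closureEmb (K := K) (w.adicCompletion K))))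
    (locLayerMod S κ θ' P w n k) (fun _ ↦ rfl) q y).symm

/-- ★★ **SEMILOCAL VANISHING = VANISHING AT EVERY PLACE ABOVE `w`, degree `2`**: `sloc²_{w,n,k} y = 0` iff `loc²_{n,w}(conj_δ y) = 0` for every `δ ∈ Γ_K` (the conjugates `loc_{n,w} ∘ conj_δ`
enumerate the localisations at the places of `K_n` above `w`; tree `map_restrict_eq_zero_iff_forall_conjMap_two` + §1). This is what `ker ρ₂` is levelwise (row S3α, α5′).
[cite: NeukirchSchmidtWingberg2008, I §5 (1.5.6)–(1.5.7), I §6 (1.6.4)–(1.6.5)] [cite: SerreLocalFields1979, VII §5] -/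
theorem semilocNK₂_eq_zero_iff (n k : ℕ) (y : cycLayerCohO S κ θ' P n k 2) :
    semilocNKq S κ θ' P w 2 n k y = 0 ↔
      ∀ δ : absoluteGaloisGroup K, ContinuousCohomology.map (locLayerHom κ P w n) (locLayerMod S κ θ' P w n k) 2 (cycLayerConjO S κ θ' P n k 2 δ y) = 0 := by
  haveI : CompactSpace (absoluteGaloisGroup (w.adicCompletion K)) := absoluteGaloisGroup_compactSpace (w.adicCompletion K)
  rw [semilocNKq_apply, semilocRes_apply, map_restrict_eq_zero_iff_forall_conjMap_two _ _ (κ.isOpen_layerSubgroup n)]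
  simp only [AddEquiv.apply_symm_apply, conjMap_inflNKq, map_comapSubtypeHom_inflNKq]
  exact Iff.rfl

end Semiloc

end Summit.BirchSwinnertonDyer.BirchSwinnertonDyer.Theorems.SmallImageRttJunctionSha

end
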